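import Summits.QuantumFields.BalabanUV.Beta.SecondOrderTransport
import Literature.MathematicalPhysics.QuantumFieldTheory.Balaban1983to89.Beta.BalabanStepW2
import Summits.QuantumFields.BalabanUV.Beta.GAN24.ThirdJetKernel

/-!
# `BalabanUV.Beta.SecondOrderStepTransport` — binder row D1, W-side (L4), piece (W-E) TRANSPORT HALF: the SHARP table laws transport through
# an2's second response-derivative `K3OfK` and its `mm`-read (the level-`(j+1)` second-order field table of the recursive W-literal)
# (β sub-cell, row BETA-an2 = BINDER-OWNERS row D1 OWNER, lineage an2 gen 17; the order-2 twin of an3's 29D `VertexSandwichTransport` §3)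

HONEST FRAMING (cell charter, verbatim): «discharging BetaPertH makes Balaban's UV stability UNCONDITIONAL — a real
constructive-QFT result; it is NOT the continuum limit and NOT the Clay problem.»  HONEST DEPENDENCY (verbatim): «continuum YM on T⁴ ⇐
BetaPertH ∧ nine spine estimates (0/9 proved); BetaPertH ⇐ (D1) ∧ (D4) ∧ CAP+tail; G-an2-4 gates asym, D1 and NE2/3/4.»  DERIVED cell leaf:
[folklore] kernel algebra; no statement of Bałaban's papers is typed here, no `[cite:]` tag, no `def`, no `Prop` fact; it instantiates NO binder
of the β-function wall.  NOT D1, NOT `BetaPertH`, NOT continuum, NOT Clay.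

## What and why

The level-`(j+1)` second-order field table of the (L4-D) literal is `T2RecAt (j+1) = (cE₂·wV4) • mmRead Lc (K3OfK G_j Lc S M W · ·) + (cB·wB2) • vh₂S`
(`SpineRecursiveW`, `e4OfKW`).  Its reflection law (leaf (W-LET-S₂) at level `j+1`) has two halves: TRANSPORT (this file) — from the sharp laws of
`S`, `M` (first order) and of `W` (second order, `W μ (bref y) ν (bref y′) = (ε ε) • refK (W♯ μ y ν y′)`) through the refK-invariant spread `K`:
**`K3OfK K N S M W μ (bref y) ν (bref y′) = (ε_μ ε_ν) • refK (Φ N α) (K3OfK K N S♯ M♯ W♯ μ y ν y′)`** (`K3OfK_bref_sharp`) and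
**`mmRead N (K3OfK … (bref y) … (bref y′)) = (ε_μ ε_ν) • refK (Φ N′ α) (mmRead N (K3OfK K N S♯ M♯ W♯ μ y ν y′))`** (`mmRead_K3OfK_bref_sharp`, any `N′`);
and EVALUATION (not here; the order-2 twin of an3's `E3CoDressedContact`): the ♯-difference `K3OfK(♯) − K3OfK` in contact form at the NEXT level.
Pieces: `comp_comp_refK_refK` (`K ∘ refK X ∘ refK Y = refK (K ∘ X ∘ Y)` for `refK K = K`), `loc_K2OfK`; `GAN24.ThirdJetKernel.mmRead_smul` BY NAME.

Provenance: β sub-cell, unit beta-an2 gen 17, 2026-08-20 (v1); BY NAME over `SecondOrderTransport` (an2), an3's `VertexReflectionContact` /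
`VertexSandwichTransport`, an2's `BalabanStepW2` (`K3OfK`), `StepLambdaReflection.refK_mmRead`; no existing file touched.
-/

noncomputable section

open Finset
open scoped BigOperators
open Literature.MathematicalPhysics.QuantumFieldTheory
open Literature.MathematicalPhysics.QuantumFieldTheory.Balaban1983to89
open Literature.MathematicalPhysics.QuantumFieldTheory.Balaban1983to89.Beta
open ExpKernelCalculus (MKer comp)
open PolarizationSign (reflSign)
open KernelReflection (LegMap refK refK_apply comp_refK)
open ResolventReflection (bref Φ)
open OneStepResolventKernel (Fib)
open BalabanStepJetsSucc (mmRead)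
open SecondOrderResponse (dM K2OfK)
open BalabanStepW2 (K3OfK)
open Summit.QuantumFields.BalabanUV.Beta.TameKernelCalculus (Spr Loc Tame slice_tame)
open Summit.QuantumFields.BalabanUV.Beta.VertexReflectionContact (refK_neg)
open Summit.QuantumFields.BalabanUV.Beta.E3LevelOneReflection (refK_add refK_smul refK_sub)
open Summit.QuantumFields.BalabanUV.Beta.SpineRooted (refK_mmRead)
open Summit.QuantumFields.BalabanUV.Beta.SecondOrderTransport (dM_bref_sharp K2OfK_bref_sharp K2OfK_eq)

namespace Summit.QuantumFields.BalabanUV.Beta.SecondOrderStepTransport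

variable {d N : ℕ}

/-! ## §1 Bricks -/

/-- [folklore] **A DOUBLE PRODUCT OF RELABELLED KERNELS BEHIND AN INVARIANT ONE**: `K ∘ refK X ∘ refK Y = refK (K ∘ X ∘ Y)` for `refK Ψ K = K`
(two `KernelReflection.comp_refK`; slice summabilities of `K ∘ X` and `(K ∘ X) ∘ Y` are the analytic input). -/
theorem comp_comp_refK_refK {D : ℕ} {F : Type*} [Fintype F] (Ψ : LegMap D F) {K X Y : MKer D F} (hK : refK Ψ K = K)
    (h1 : ∀ x z a f b, Summable fun y : Fin D → ℤ => K x y a f * X y z f b)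
    (h2 : ∀ x z a f b, Summable fun y : Fin D → ℤ => comp K X x y a f * Y y z f b) :
    comp (comp K (refK Ψ X)) (refK Ψ Y) = refK Ψ (comp (comp K X) Y) := by
  conv_lhs => rw [← hK]
  rw [comp_refK Ψ h1, comp_refK Ψ h2]

/-- [folklore] `K2OfK K N S M c` is localised for a spread `K` and a localised `dM K N S M c`. -/
theorem loc_K2OfK [NeZero N] {K : MKer (d + 1) (Fib d)} (hKs : Spr K) {S M : Fin (d + 1) → (Fin (d + 1) → ℤ) → MKer (d + 1) (Fib d)}
    (ν : Fin (d + 1)) (y' : Fin (d + 1) → ℤ) (hD : Loc (dM K N S M ν y')) : Loc (K2OfK K N S M ν y') := by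
  rw [K2OfK_eq]
  exact ((hKs.comp_loc hD).comp_spr hKs).neg

/-! ## §2 The transport through `K3OfK` -/

section Transport

variable [NeZero N] {K : MKer (d + 1) (Fib d)} {α : Fin (d + 1)}

/-- [folklore] **THE SECOND RESPONSE-DERIVATIVE TRANSPORTS WITH THE ♯-TABLES**: for a spread, reflection-invariant `K`, first-order sharp laws of
`S`, `M`, a second-order sharp law of `W` (any ♯-bi-table `W♯`), and the localisations of `dM K N S♯ M♯ ·` and `W♯ · ·`,
`K3OfK K N S M W μ (bref y) ν (bref y′) = (ε_μ ε_ν) • refK (Φ N α) (K3OfK K N S♯ M♯ W♯ μ y ν y′)`. -/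
theorem K3OfK_bref_sharp (hK : refK (Φ N α) K = K) (hKs : Spr K)
    {S Sg M Mg : Fin (d + 1) → (Fin (d + 1) → ℤ) → MKer (d + 1) (Fib d)}
    {W Wg : Fin (d + 1) → (Fin (d + 1) → ℤ) → Fin (d + 1) → (Fin (d + 1) → ℤ) → MKer (d + 1) (Fib d)}
    (hS : ∀ κ' u', S κ' (bref α κ' u') = reflSign α κ' • refK (Φ N α) (Sg κ' u'))
    (hM : ∀ ρ w, M ρ (bref α ρ w) = reflSign α ρ • refK (Φ N α) (Mg ρ w))
    (hW : ∀ μ y ν y', W μ (bref α μ y) ν (bref α ν y') = (reflSign α μ * reflSign α ν) • refK (Φ N α) (Wg μ y ν y'))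
    (hD : ∀ ν y', Loc (dM K N Sg Mg ν y')) (hWl : ∀ μ y ν y', Loc (Wg μ y ν y'))
    (μ : Fin (d + 1)) (y : Fin (d + 1) → ℤ) (ν : Fin (d + 1)) (y' : Fin (d + 1) → ℤ) :
    K3OfK K N S M W μ (bref α μ y) ν (bref α ν y') = (reflSign α μ * reflSign α ν) • refK (Φ N α) (K3OfK K N Sg Mg Wg μ y ν y') := by
  have hKt : Tame K := hKs.tame
  have hE : ∀ (ν : Fin (d + 1)) (y' : Fin (d + 1) → ℤ), Loc (K2OfK K N Sg Mg ν y') := fun ν y' => loc_K2OfK hKs ν y' (hD ν y')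
  -- the three products
  have t1 : comp (comp K (dM K N S M μ (bref α μ y))) (K2OfK K N S M ν (bref α ν y')) =
      (reflSign α μ * reflSign α ν) • refK (Φ N α) (comp (comp K (dM K N Sg Mg μ y)) (K2OfK K N Sg Mg ν y')) := by
    rw [dM_bref_sharp hK hS hM μ y, K2OfK_bref_sharp hK hKs hS hM hD ν y', KernelReflection.comp_smul_right, KernelReflection.comp_smul_right,
      KernelReflection.comp_smul_left, smul_smul, mul_comm (reflSign α ν) (reflSign α μ),
      comp_comp_refK_refK (Φ N α) hK (fun x z a f b => slice_tame hKt (hD μ y).tame x z a f b)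
        (fun x z a f b => slice_tame (hKs.comp_loc (hD μ y)).tame (hE ν y').tame x z a f b)]
  have t2 : comp (comp K (dM K N S M ν (bref α ν y'))) (K2OfK K N S M μ (bref α μ y)) =
      (reflSign α μ * reflSign α ν) • refK (Φ N α) (comp (comp K (dM K N Sg Mg ν y')) (K2OfK K N Sg Mg μ y)) := by
    rw [dM_bref_sharp hK hS hM ν y', K2OfK_bref_sharp hK hKs hS hM hD μ y, KernelReflection.comp_smul_right, KernelReflection.comp_smul_right,
      KernelReflection.comp_smul_left, smul_smul,
      comp_comp_refK_refK (Φ N α) hK (fun x z a f b => slice_tame hKt (hD ν y').tame x z a f b)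
        (fun x z a f b => slice_tame (hKs.comp_loc (hD ν y')).tame (hE μ y).tame x z a f b)]
  have t3 : comp (comp K (W μ (bref α μ y) ν (bref α ν y'))) K =
      (reflSign α μ * reflSign α ν) • refK (Φ N α) (comp (comp K (Wg μ y ν y')) K) := by
    rw [hW, KernelReflection.comp_smul_right, KernelReflection.comp_smul_left,
      VertexReflectionContact.sandwich_refK (Φ N α) hK (fun x z a f b => slice_tame hKt (hWl μ y ν y').tame x z a f b)
        (fun x z a f b => slice_tame (hKs.comp_loc (hWl μ y ν y')).tame hKt x z a f b)]
  have eL : K3OfK K N S M W μ (bref α μ y) ν (bref α ν y') =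
      -(comp (comp K (dM K N S M μ (bref α μ y))) (K2OfK K N S M ν (bref α ν y'))) -
        comp (comp K (dM K N S M ν (bref α ν y'))) (K2OfK K N S M μ (bref α μ y)) - comp (comp K (W μ (bref α μ y) ν (bref α ν y'))) K := by
    funext x z a b; rfl
  have eR : K3OfK K N Sg Mg Wg μ y ν y' =
      -(comp (comp K (dM K N Sg Mg μ y)) (K2OfK K N Sg Mg ν y')) - comp (comp K (dM K N Sg Mg ν y')) (K2OfK K N Sg Mg μ y) -
        comp (comp K (Wg μ y ν y')) K := by
    funext x z a b; rfl
  rw [eL, eR, t1, t2, t3, ← smul_neg, ← smul_sub, ← smul_sub, ← refK_neg, ← refK_sub, ← refK_sub]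

/-- [folklore] **THE `mm`-READ OF THE TRANSPORTED SECOND RESPONSE-DERIVATIVE** (the level-`(j+1)` second-order field table's field sector,
`SpineRecursiveW.e4OfKW`): `mmRead N (K3OfK K N S M W μ (bref y) ν (bref y′)) = (ε_μ ε_ν) • refK (Φ N′ α) (mmRead N (K3OfK K N S♯ M♯ W♯ μ y ν y′))`
for ANY coarse blocking `N′` of the leg map (the read has field legs only; `SpineRooted.refK_mmRead`). -/
theorem mmRead_K3OfK_bref_sharp (N' : ℕ) (hK : refK (Φ N α) K = K) (hKs : Spr K)
    {S Sg M Mg : Fin (d + 1) → (Fin (d + 1) → ℤ) → MKer (d + 1) (Fib d)}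
    {W Wg : Fin (d + 1) → (Fin (d + 1) → ℤ) → Fin (d + 1) → (Fin (d + 1) → ℤ) → MKer (d + 1) (Fib d)}
    (hS : ∀ κ' u', S κ' (bref α κ' u') = reflSign α κ' • refK (Φ N α) (Sg κ' u'))
    (hM : ∀ ρ w, M ρ (bref α ρ w) = reflSign α ρ • refK (Φ N α) (Mg ρ w))
    (hW : ∀ μ y ν y', W μ (bref α μ y) ν (bref α ν y') = (reflSign α μ * reflSign α ν) • refK (Φ N α) (Wg μ y ν y'))
    (hD : ∀ ν y', Loc (dM K N Sg Mg ν y')) (hWl : ∀ μ y ν y', Loc (Wg μ y ν y'))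
    (μ : Fin (d + 1)) (y : Fin (d + 1) → ℤ) (ν : Fin (d + 1)) (y' : Fin (d + 1) → ℤ) :
    mmRead N (K3OfK K N S M W μ (bref α μ y) ν (bref α ν y')) =
      (reflSign α μ * reflSign α ν) • refK (Φ (d := d) N' α) (mmRead N (K3OfK K N Sg Mg Wg μ y ν y')) := by
  rw [K3OfK_bref_sharp hK hKs hS hM hW hD hWl μ y ν y', GAN24.ThirdJetKernel.mmRead_smul, ← refK_mmRead N N' α]

end Transport

end Summit.QuantumFields.BalabanUV.Beta.SecondOrderStepTransport

end
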